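import Literature.IUT.HodgeArakelov.MonoThetaProjectiveThetaEnvFacts
import Literature.AnabelianGeometry.EtaleTheta.SettingModelChiGroupLevelHolds
import Literature.AnabelianGeometry.EtaleTheta.SettingModelChiTheta
import Literature.AnabelianGeometry.EtaleTheta.SettingModelChiKummerData
import HarnessLib

/-!
# [IUTchII] Prop. 1.5 (ii)+(iii) — the `θ_env` data of the NATURAL system — and the four-clause Prop. 1.5 summary
# AT THE RECORD MODEL `ThetaSetting.modelχ p` (proof-only capstone; DAG node IUTchII:Prop1.5(iii))

S. Mochizuki, *Inter-universal Teichmüller theory II*, kurims manuscript (Dec. 2020), Prop. 1.5 (ii), (iii) pp. 29–30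
[claim: Mochizuki2012, status: disputed] (IUTchII §1 Prop 1.5 (iii), kurims pp.29-30): "(iii) … one may construct
… a cyclotomic rigidity isomorphism … `(l·Δ_Θ)(M^Θ_*) ⥲ Π_μ(M^Θ_*)` … [and] `θ̲_env(M^Θ_*)`"; S. Mochizuki, *The
étale theta function …*, Publ. RIMS **45** (2009) [EtTh], Cor. 2.18 (i) p. 60, Cor. 2.19 (ii) p. 64 (PRIMS PDF pages)
[cite: MochizukiEtTh2009, Cor 2.19(ii) p.64]; [SemiAnbd] Ex. 3.10 p. 45 [cite: MochizukiSemiAnbd2006, Ex 3.10 p.45].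
Cell `abc-iut`, block F, seat abc-iut-f-150 (gen 2); sequel of this seat's `MonoThetaProjectiveBridgeEtThAtModelChi`
((i), (i)′, (ii) at the record model).  PROOF-ONLY: no definition, no instance, no new named fact (the instances on
`(modelχ p).Δ_Θ` needed to state the root cocycle are abc-iut-w5-d171's, `SettingModelChiKummerData.lean`).

abc-iut-L2-t10's `MonoThetaProjectiveThetaEnvFacts.lean` proves, for the model family of `X̲̲_K` over ANY [EtTh] §1
theta setting `D`, (a) `Prop15_ii_iii (modelSystem …)` and the existence of the `θ_env` data modulo Prop. 1.5 (iii),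
the cusp labels, Cor. 2.18 (i) at the chain levels, `ThetaEnvTower.Cor219_iii` (for (ii)), Prop. 1.5 (ii), and the
§1 origin clauses `IsEtThOrigin`, `hYcl` (for the system's input "`(l·Δ_Θ)(M) ≅ Ẑ`"); (b) the four-clause summary
`prop15_i_i'_ii_iii_modelSystem_of_origin` modulo that list plus temp-slimness of `Π^tp_X` and `IsOpenMap D.aug`.
AT THE RECORD MODEL `D := ThetaSetting.modelχ p` (`Π^tp_X = Γ ⋊_χ G_{ℚ_p}`) the clauses `IsEtThOrigin`
(`modelχ_isEtThOrigin`), `hYcl` (`hYcl_modelχ`), `IsSlimGroup Π^tp_X` (`isSlimGroup_piTemp_curveχ`) and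
`IsOpenMap aug` (`isOpenMap_aug_modelχ`) are THEOREMS, whence, for every étale-theta datum `E` over `modelχ p`,
every `X̲̲`, tower `τ` and root cocycle `f`:

* `nonempty_thetaEnvData_modelχ` — the `θ_env` data of the natural system EXIST modulo Prop. 1.5 (iii), `L` and
  Cor. 2.18 (i) at the chain level `1` only;
* `prop15_ii_iii_modelSystem_modelχ` — Prop. 1.5 (ii)+(iii) modulo Prop. 1.5 (ii), (iii), `L`, Cor. 2.18 (i) at the
  chain levels, `ThetaEnvTower.Cor219_iii`;
* `prop15_i_i'_ii_iii_modelSystem_modelχ` — (i) (printed form), (i)′, (ii)+(iii) under the SAME residual list.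

HONEST LABEL: semi-synthetic model (not the tempered `π₁` of a curve): joint-satisfiability evidence for the
interface / origin binders of the [IUTchII] Prop. 1.5 model discharge; [IUTchII] claim key DISPUTED (D-0012), nothing
of it asserted; nothing of [EtTh] / [SemiAnbd] asserted; no side taken on [IUTchIII] Cor. 3.12; typed ≠ proved.
-/

noncomputable section

namespace Literature.IUT.HodgeArakelov

open Literature.AnabelianGeometry.EtaleTheta Literature.AnabelianGeometry.SemiGraphs
open scoped Literature.AnabelianGeometry.EtaleTheta

namespace EtaleLevels

variable (p : ℕ) [Fact p.Prime]
  {E : (ThetaSetting.modelχ p).EtaleThetaData} {l : ℕ} (C : E.DoubleUnderline l)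
  (hC : (ThetaSetting.modelχ p).Compat) (hS : (ThetaSetting.modelχ p).Sec2Hyps)
  (hl : l.Prime) (hp2 : p ≠ 2) (hpl : p ≠ l) (hζ : ∃ ζ : (ThetaSetting.modelχ p).K, IsPrimitiveRoot ζ (4 * l))
  {Es : Set ℕ+} (τ : (ThetaSetting.modelχ p).CyclotomeTower l Es)
  (f : contCocycles (ThetaSetting.modelχ p).toTheta (ThetaSetting.modelχ p).DeltaTheta C.GtpYdduu)
  (hf : f ∈ C.rootCocycles hC)

/-- **[IUTchII] Prop. 1.5 (iii) AT THE RECORD MODEL: the `θ_env` data of the natural system EXIST** (exterior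
cyclotomes, the limit cyclotomic rigidity isomorphism, `θ_env`: `Nonempty (ThetaEnvData modelSystem)`), modulo
Prop. 1.5 (iii), the cusp labels and [EtTh] Cor. 2.18 (i) at the chain level `1` only — abc-iut-L2-t10's
`nonempty_thetaEnvData_of_origin` with `IsEtThOrigin := modelχ_isEtThOrigin`, `hYcl := hYcl_modelχ`.
[claim: Mochizuki2012, status: disputed] (IUTchII §1 Prop 1.5 (iii), kurims pp.29-30) [cite: MochizukiEtTh2009, Cor 2.18(i) p.60] -/
theorem nonempty_thetaEnvData_modelχ
    (h15 : Literature.AnabelianGeometry.EtaleTheta.ThetaSetting.Prop15iii E hC) (L : C.CuspLabels)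
    (h218i₁ : (C.rigidData (τ.mod ⟨1, τ.one_mem⟩) hC hS h15 L).Cor218_i) :
    Nonempty (ThetaEnvData
      (modelSystem C hC hS hl hp2 hpl hζ τ.modAll f hf τ.red_modAll h15 L (fun M =>
        ModelCyclotomes.nonempty_lDeltaQuot_rigidData_mulEquiv_zHat C (τ.modAll M) hC hS h15 L
          (ThetaSetting.modelχ_isEtThOrigin p) (SettingModel.hYcl_modelχ p) hl.ne_zero))) :=
  nonempty_thetaEnvData_of_origin C hC hS hl hp2 hpl hζ τ f hf h15 L h218i₁ (ThetaSetting.modelχ_isEtThOrigin p)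
    (SettingModel.hYcl_modelχ p)

/-- **[IUTchII] Prop. 1.5 (ii)+(iii) for the natural system AT THE RECORD MODEL** (`Prop15_ii_iii (modelSystem …)`),
modulo Prop. 1.5 (ii), (iii), the cusp labels, [EtTh] Cor. 2.18 (i) at the chain levels and `ThetaEnvTower.Cor219_iii`
— abc-iut-L2-t10's `prop15_ii_iii_modelSystem_of_origin` with `IsEtThOrigin`, `hYcl` SUPPLIED.
[claim: Mochizuki2012, status: disputed] (IUTchII §1 Prop 1.5 (iii), kurims pp.29-30) [cite: MochizukiEtTh2009, Cor 2.19(ii) p.64] -/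
theorem prop15_ii_iii_modelSystem_modelχ
    (h15 : Literature.AnabelianGeometry.EtaleTheta.ThetaSetting.Prop15iii E hC)
    (h15ii : Literature.AnabelianGeometry.EtaleTheta.ThetaSetting.Prop15ii E.toKummerData hC)
    (L : C.CuspLabels)
    (h218i : ∀ e : Es, (C.rigidData (τ.mod e) hC hS h15 L).Cor218_i)
    (h219iii : (C.thetaEnvTower τ hC hS).Cor219_iii) :
    Literature.IUT.HodgeArakelov.Prop15_ii_iii
      (modelSystem C hC hS hl hp2 hpl hζ τ.modAll f hf τ.red_modAll h15 L (fun M =>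
        ModelCyclotomes.nonempty_lDeltaQuot_rigidData_mulEquiv_zHat C (τ.modAll M) hC hS h15 L
          (ThetaSetting.modelχ_isEtThOrigin p) (SettingModel.hYcl_modelχ p) hl.ne_zero)) :=
  prop15_ii_iii_modelSystem_of_origin C hC hS hl hp2 hpl hζ τ f hf h15 h15ii L h218i h219iii
    (ThetaSetting.modelχ_isEtThOrigin p) (SettingModel.hYcl_modelχ p)

/-- **[IUTchII] Prop. 1.5 (i) (printed form), (i)′, (ii)+(iii) for the model family of `X̲̲` AT THE RECORD MODEL,
under ONE residual binder list** — Prop. 1.5 (ii), (iii) of [EtTh] §1, the cusp labels, [EtTh] Cor. 2.18 (i) at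
every chain level, `ThetaEnvTower.Cor219_iii` — abc-iut-L2-t10's `prop15_i_i'_ii_iii_modelSystem_of_origin` with
its four interface / origin binders (temp-slimness of `Π^tp_X`, `IsOpenMap D.aug`, `IsEtThOrigin`, `hYcl`) SUPPLIED
by the record model's theorems. [claim: Mochizuki2012, status: disputed] (IUTchII §1 Prop 1.5, kurims pp.29-30)
[cite: MochizukiEtTh2009, Cor 2.19(ii) p.64] -/
theorem prop15_i_i'_ii_iii_modelSystem_modelχ
    (h15 : Literature.AnabelianGeometry.EtaleTheta.ThetaSetting.Prop15iii E hC)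
    (h15ii : Literature.AnabelianGeometry.EtaleTheta.ThetaSetting.Prop15ii E.toKummerData hC)
    (L : C.CuspLabels)
    (h218i : ∀ e : Es, (C.rigidData (τ.mod e) hC hS h15 L).Cor218_i)
    (h219iii : (C.thetaEnvTower τ hC hS).Cor219_iii) :
    Literature.IUT.HodgeArakelov.Prop15_ii_iii
        (modelSystem C hC hS hl hp2 hpl hζ τ.modAll f hf τ.red_modAll h15 L (fun M =>
          ModelCyclotomes.nonempty_lDeltaQuot_rigidData_mulEquiv_zHat C (τ.modAll M) hC hS h15 L
            (ThetaSetting.modelχ_isEtThOrigin p) (SettingModel.hYcl_modelχ p) hl.ne_zero)) ∧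
      (∀ (B : MonoThetaProjSystem (modelFamily C hC hS hl hp2 hpl hζ τ.modAll f hf)),
        B.IsMonoThetaCompatible
          (reductions C hC hS hl hp2 hpl hζ τ.modAll f hf τ.red_modAll (SettingModel.isSlimGroup_piTemp_curveχ p)) →
        Prop15_i (modelSystem C hC hS hl hp2 hpl hζ τ.modAll f hf τ.red_modAll h15 L (fun M =>
          ModelCyclotomes.nonempty_lDeltaQuot_rigidData_mulEquiv_zHat C (τ.modAll M) hC hS h15 L
            (ThetaSetting.modelχ_isEtThOrigin p) (SettingModel.hYcl_modelχ p) hl.ne_zero)) B) ∧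
      ∀ (A B : MonoThetaProjSystem (modelFamily C hC hS hl hp2 hpl hζ τ.modAll f hf)),
        Literature.IUT.HodgeArakelov.Prop15_i'
          (reductions C hC hS hl hp2 hpl hζ τ.modAll f hf τ.red_modAll (SettingModel.isSlimGroup_piTemp_curveχ p))
          A B :=
  prop15_i_i'_ii_iii_modelSystem_of_origin C hC hS hl hp2 hpl hζ τ f hf (SettingModel.isSlimGroup_piTemp_curveχ p)
    (SettingModel.isOpenMap_aug_modelχ p) h15 h15ii L h218i h219iii (ThetaSetting.modelχ_isEtThOrigin p)
    (SettingModel.hYcl_modelχ p)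

end EtaleLevels

end Literature.IUT.HodgeArakelov

end
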